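import Summits.MatrixMultiplication.OmegaCensus.STPP211TFirstReflectG
import Summits.MatrixMultiplication.OmegaCensus.STPP211TFirstEngine2

/-!
# ω-census, `(2,1,1)^k` T-first kernel engine v1.5 — reflection (the shallow dynamic chooser changes nothing)

HONEST FRAMING (pub-omega census; verbatim): lottery ticket; floor = certified bounds/negative ranges.
Census STRUCTURE bookkeeping of the STPP track (seat pub-omega-stpp-1, gen 38; STRUCTURE row B5), not progress on `ω`.

Reflection of `STPP211TFirstEngine2.lean` through Def. 5.1: the v1 chain `…ReflectA–G` is reused verbatim except where the
placement search appears by name.  §8′ `psearch2_false` (v1 §8 with the depth argument; the proposal `sb` is now re-checked to be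
ONE open sentinel bit, so the chooser stays opaque), §9′ the leaf, §14′ the search below the roots reaches the leaf, §15′/16′ the
normal form and **`not_exists_isSTPP_211_of_tfirst2`** (hypotheses `unitsOK`, v1 `runFrontier`, v1.5 `runRoots2`).

References: H. Cohn, R. Kleinberg, B. Szegedy, C. Umans, FOCS 2005 (arXiv:math/0511460), Def. 5.1.
-/

namespace Summit.MatrixMultiplication.OmegaCensus

namespace STPP211T

open STPP211Neg
open Literature.Barriers.RiemannHypothesis.TuranCheck (beq_true_iff)
open Literature.Computability.AlgebraicComplexity

/-- `runRoots2` is a conjunction over the root list (chunk assembly). -/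
theorem runRoots2_append (n K : ℕ) (units : List ℕ) (R₁ R₂ : List (List ℕ)) :
    runRoots2 n K units (R₁ ++ R₂) = (runRoots2 n K units R₁ && runRoots2 n K units R₂) := by
  unfold runRoots2; rw [withTC_eq, withTC_eq, withTC_eq, force_eq, force_eq, force_eq, tsearchRoots2_append]

/-- A nonzero `x` with `x &&& (x − 1) = 0` is a single bit. -/
theorem single_bit {x : ℕ} (hx : x ≠ 0) (h : Nat.land x (Nat.sub x 1) = 0) : ∃ i, x = 2 ^ i := by
  obtain ⟨i, hi, hbits⟩ := testBit_land_pred hx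
  refine ⟨i, Nat.eq_of_testBit_eq fun j => ?_⟩
  rw [Nat.testBit_two_pow]
  by_cases hij : i = j
  · subst hij; simp [hi]
  · have := hbits j
    rw [land_eq, sub_eq'] at h
    rw [h, Nat.zero_testBit] at this
    have hne : (j == i) = false := by simp [Ne.symm hij]
    rw [hne] at this
    simp only [Bool.not_false, Bool.and_true] at this
    rw [← this]; simp [hij]

section V15

variable {n K : ℕ} [NeZero n] (units : List ℕ) (PT : ℕ) {L : List ℕ} {OC : ℕ} {p q cz : Fin K → ZMod n}

/-- **THE PLACEMENT SEARCH NEVER REFUTES THE SOLUTION**: from a state satisfying the invariant, `psearch` returns `false`. -/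
theorem psearch2_false (hn : 1 ≤ n) (hK : 1 ≤ K) (hM : ModelD p q cz) (hD : LeafData n K L OC cz)
    (hor : ∀ l, (p l).val < (q l).val) :
    ∀ (fuel d : ℕ) (O1 O2 : Finset (Fin K)) (M S1 S2 : ℕ), Inv n K p q O1 O2 M S1 S2 →
      psearch2 (mkTC n K units) PT (EPupT n K units L OC) fuel d M S1 S2 = false := by
  intro fuel
  induction fuel with
  | zero => intro _ _ _ _ _ _ _; rfl
  | succ fuel ih =>
      intro d O1 O2 M S1 S2 hI
      show pnode2 (mkTC n K units) PT (EPupT n K units L OC) (psearch2 (mkTC n K units) PT (EPupT n K units L OC) fuel) d M S1 S2 = false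
      unfold pnode2
      simp only [force_eq]
      rw [dead1_false units hI, Bool.false_or, dead2_false units hM hI, Bool.false_or]
      -- the branching part
      generalize hsb : (@Bool.rec (fun _ => ℕ) (lowBit (chooseBit (mkTC n K units) _ _ S1 S2 (Nat.lor S1 S2)))
        (chooseDyn (mkTC n K units) PT M (Nat.lor S1 S2)) (Nat.ble d 4)) = sb
      cases hS : Nat.beq (Nat.lor S1 S2) 0
      · rw [Bool.not_false, Bool.true_and]
        cases hg1 : Nat.beq sb 0
        · cases hgp : Nat.beq (Nat.land sb (Nat.sub sb 1)) 0
          · simp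
          cases hg2 : Nat.beq (Nat.land (Nat.lor S1 S2) sb) sb
          · simp
          · rw [Bool.not_false, Bool.true_and, Bool.true_and, Bool.true_and]
            -- sb is ONE sentinel bit of an open lane l
            have hsb0 : sb ≠ 0 := fun e => by rw [e] at hg1; exact Bool.noConfusion hg1
            obtain ⟨i, hLi⟩ := single_bit hsb0 (beq_true_iff.1 hgp)
            have hSi : (Nat.lor S1 S2).testBit i = true := by
              have := congrArg (fun x => Nat.testBit x i) (beq_true_iff.1 hg2)
              simp only [land_eq, Nat.testBit_land, hLi, Nat.testBit_two_pow_self, Bool.and_true] at this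
              exact this
            rw [lor_eq, Nat.testBit_lor, Bool.or_eq_true] at hSi
            have hl : ∃ l : Fin K, i = posn n l.val n ∧ (l ∈ O1 ∨ l ∈ O2) := by
              rcases hSi with h | h
              · obtain ⟨l, hl, rfl⟩ := (hI.2.1 i).1 h; exact ⟨l, rfl, Or.inl hl⟩
              · obtain ⟨l, hl, rfl⟩ := (hI.2.2.1 i).1 h; exact ⟨l, rfl, Or.inr hl⟩
            obtain ⟨l, rfl, hl⟩ := hl
            have hsbl : sb = sbit n l.val := hLi
            subst hsbl
            exact children_false hn hK hM hD hor ih hI l hl _ _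
        · simp
      · simp
where
  /-- the children of the solution's branch along the open lane `l` are not all refuted -/
  children_false (hn : 1 ≤ n) (hK : 1 ≤ K) (hM : ModelD p q cz) (hD : LeafData n K L OC cz)
      (hor : ∀ l, (p l).val < (q l).val) {fuel : ℕ}
      (ih : ∀ (d : ℕ) (O1 O2 : Finset (Fin K)) (M S1 S2 : ℕ), Inv n K p q O1 O2 M S1 S2 →
        psearch2 (mkTC n K units) PT (EPupT n K units L OC) fuel d M S1 S2 = false)
      {O1 O2 : Finset (Fin K)} {M S1 S2 : ℕ} (hI : Inv n K p q O1 O2 M S1 S2) (l : Fin K) (hl : l ∈ O1 ∨ l ∈ O2) (tg d' : ℕ) :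
      children (mkTC n K units) (psearch2 (mkTC n K units) PT (EPupT n K units L OC) fuel d') M S1 S2 (sbit n l.val)
        (EPlT n K units L OC l.val) tg = false := by
    unfold children
    simp only [force_eq]
    rw [land_sbit_eq hn hI.2.2.1 l]
    have hV : ∀ x : ZMod n, M.testBit (posn n l.val x.val) = true →
        (laneVal (mkTC n K units) M (sbit n l.val)).testBit x.val = true := fun x hx => by
      rw [sbit_eq, posn_eq, testBit_laneVal, decide_eq_true (ZMod.val_lt x), Bool.true_and, ← posn_eq]; exact hx
    have hVle : laneVal (mkTC n K units) M (sbit n l.val) ≤ laneVal (mkTC n K units) M (sbit n l.val) := le_rfl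
    rcases hl with hl | hl
    · -- second member: l ∈ O1, l ∉ O2
      have hl2 : l ∉ O2 := fun h => Finset.disjoint_left.1 hI.1 hl h
      simp only [hl2, not_false_eq_true, decide_true, Bool.not_true]
      show allLow _ _ _ = false
      by_contra hall
      rw [Bool.not_eq_false] at hall
      have hb := allLow_spec _ _ _ hVle hall (q l).val (hV (q l) (hI.2.2.2.2.2 l hl))
      have hf := ih d' _ _ _ _ _ (inv_child1 units hn hK hM hD hI hl tg)
      unfold killT at hf
      rw [hf] at hb
      exact Bool.noConfusion hb
    · -- first member: l ∈ O2
      simp only [hl, not_true_eq_false, decide_false, Bool.not_false]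
      show allLow _ _ _ = false
      by_contra hall
      rw [Bool.not_eq_false] at hall
      have hb := allLow_spec _ _ _ hVle hall (p l).val (hV (p l) (hI.2.2.2.2.1 l hl).1)
      have hf := ih d' _ _ _ _ _ (inv_child2 units hn hK hM hD hor hI hl tg)
      unfold killT at hf
      rw [hf] at hb
      exact Bool.noConfusion hb


omit [NeZero n] in
/-- `tleaf2 = true` unfolded: the order re-check passed and the placement search from the initial state answered `true`. -/
theorem tleaf2_true {L : List ℕ} (h : tleaf2 (mkTC n K units) PT L (maskL L) = true) :
    orderOK (mkTC n K units) (maskL L) (OCT n K units L) = true ∧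
    psearch2 (mkTC n K units) PT (EPupT n K units L (OCT n K units L)) (2 * K + 1) 1 (M0T n K units L (OCT n K units L))
      (sbit n 0) (Nat.xor (mkTC n K units).sent (sbit n 0)) = true := by
  have h' : (orderOK (mkTC n K units) (maskL L) (OCT n K units L) &&
      psearch2 (mkTC n K units) PT (EPupT n K units L (OCT n K units L)) (2 * K + 1) 1 (M0T n K units L (OCT n K units L))
        (sbit n 0) (Nat.xor (mkTC n K units).sent (sbit n 0))) = true := by
    have := h; unfold tleaf2 at this; simp only [force_eq] at this; exact this
  exact Bool.and_eq_true_iff.1 h'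

/-- **THE LEAF NEVER REFUTES A NORMALISED SOLUTION.** -/
theorem leaf2_false (hn : 1 ≤ n) (hn64 : n ≤ 64) (hK : 1 ≤ K) (hM : ModelD p q cz) (hD : LeafData n K L (OCT n K units L) cz)
    (hor : ∀ l, (p l).val < (q l).val) (hp0 : p ⟨0, hK⟩ = 0) (hq0 : 1 ≤ (q ⟨0, hK⟩).val ∧ (q ⟨0, hK⟩).val ≤ n / 2)
    (h : tleaf2 (mkTC n K units) PT L (maskL L) = true) : False := by
  have h1 := (tleaf2_true units PT h).2
  rw [psearch2_false units PT hn hK hM hD hor _ _ _ _ _ _ _ (inv_init units hn hn64 hK hM hD hp0 hq0)] at h1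
  exact Bool.noConfusion h1


end V15

section V15b

variable {n K : ℕ} [NeZero n] (units : List ℕ) (PT : ℕ)

/-- `tsearchRoots = true` refutes every listed root. -/
theorem rootSearch2_of_tsearchRoots2 (c : TC) (PT : ℕ) {roots : List (List ℕ)} (h : tsearchRoots2 c PT roots = true) :
    ∀ R ∈ roots, rootSearch2 c PT R = true := by
  induction roots with
  | nil => intro R hR; simp at hR
  | cons L R ih =>
      rw [tsearchRoots2_cons, Bool.and_eq_true] at h
      intro R' hR'
      rcases List.mem_cons.1 hR' with rfl | hR'
      · exact h.1
      · exact ih h.2 R' hR'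

variable {S : Finset (ZMod n)} {t : ℕ → ℕ}

/-- **A `true` SEARCH BELOW THE DEPTH-`J` PREFIX REACHES THE LEAF** of the canonical set: the leaf answered `true`. -/
theorem tleaf2_of_roots (hu : ∀ u ∈ units, Nat.Coprime u n) (hC : Canon n K S t) {J : ℕ} (hJ : 1 ≤ J) (hJK : J ≤ K)
    {roots : List (List ℕ)} (hmem : Ld t J ∈ roots) (h : tsearchRoots2 (mkTC n K units) PT roots = true) :
    tleaf2 (mkTC n K units) PT (Ld t K) (maskL (Ld t K)) = true := by
  have key : ∀ r j, j + r = K → 1 ≤ j → tsearch2 (mkTC n K units) PT r (Ld t j) (maskL (Ld t j)) = true →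
      tleaf2 (mkTC n K units) PT (Ld t K) (maskL (Ld t K)) = true := by
    intro r
    induction r with
    | zero => intro j hj _ hr; rw [Nat.add_zero] at hj; subst hj; exact hr
    | succ r ih =>
        intro j hj hj1 hr
        exact ih (j + 1) (by omega) (by omega) (tnode_step units hu hC hj1 (by omega) _ hr)
  have hR := rootSearch2_of_tsearchRoots2 _ PT h _ hmem
  unfold rootSearch2 at hR
  rw [force_eq, force_eq, mkTC_K, lengthL_Ld] at hR
  exact key (K - J) J (by omega) hJ hR

/-- **THE LEAF NORMAL FORM.** A solution whose `c`-set is the canonical `S` (enumerated by `t`) contradicts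
`tleaf … (Ld t K) = true`. -/
theorem leaf2_contra (hn : 1 ≤ n) (hn64 : n ≤ 64) (hC : Canon n K S t) {p q c : Fin K → ZMod n} (hM : ModelD p q c)
    (hcS : ∀ x, x ∈ S ↔ ∃ i, c i = x) (h : tleaf2 (mkTC n K units) PT (Ld t K) (maskL (Ld t K)) = true) : False := by
  classical
  have hK := hC.pos
  obtain ⟨h0, hdist, hbits⟩ := orderOK_true units (tleaf2_true units PT h).1
  set OC := OCT n K units (Ld t K)
  -- every listed code is the code of a class
  have hcode : ∀ j : Fin K, ∃ i : Fin K, (c i).val = codeAt OC j.val := by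
    intro j
    have h1 : (maskL (Ld t K)).testBit (codeAt OC j.val) = true := (hbits _).2 ⟨j.val, j.isLt, rfl⟩
    rw [testBit_maskL] at h1
    have h2 := (mem_Ld t K _).1 (of_decide_eq_true h1)
    have h3 := (hC.mem _).2 h2
    unfold codes at h3; rw [Finset.mem_image] at h3
    obtain ⟨x, hx, hxv⟩ := h3
    obtain ⟨i, rfl⟩ := (hcS x).1 hx
    exact ⟨i, hxv⟩
  choose σ hσ using hcode
  have hσinj : Function.Injective σ := by
    intro j j' e
    by_contra hne
    exact hdist j.val j'.val j.isLt j'.isLt (fun h => hne (Fin.ext h)) (by rw [← hσ j, ← hσ j', e])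
  -- re-indexed solution
  have hM1 : ModelD (p ∘ σ) (q ∘ σ) (c ∘ σ) := hM.reindex σ hσinj
  have hD : LeafData n K (Ld t K) OC (c ∘ σ) := by
    refine ⟨fun e he => ?_, fun j => ?_, fun l => (hσ l).symm⟩
    · have h1 : (maskL (Ld t K)).testBit e = true := by rw [testBit_maskL]; simp [he]
      obtain ⟨j, hj, hje⟩ := (hbits e).1 h1
      exact ⟨⟨j, hj⟩, by rw [Function.comp_apply, hσ ⟨j, hj⟩, hje]⟩
    · have h1 : (maskL (Ld t K)).testBit (codeAt OC j.val) = true := (hbits _).2 ⟨j.val, j.isLt, rfl⟩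
      rw [testBit_maskL] at h1
      rw [Function.comp_apply, hσ j]; exact of_decide_eq_true h1
  -- translate the pairs: class 0 gets {0, d} with d.val ≤ n/2
  set i0 : Fin K := ⟨0, hK⟩
  have hpq : (p ∘ σ) i0 ≠ (q ∘ σ) i0 := hM1.1 i0
  -- generic finishing step from a model with p i0 = 0 and 1 ≤ (q i0).val ≤ n/2
  have finish : ∀ (p' q' : Fin K → ZMod n), ModelD p' q' (c ∘ σ) → p' i0 = 0 → 1 ≤ (q' i0).val → (q' i0).val ≤ n / 2 →
      False := by
    intro p' q' hM' hp0 hq1 hq2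
    have hMo := hM'.orient (zmodEnc n)
    have henc : ∀ x : ZMod n, (zmodEnc n).enc x = x.val := fun x => rfl
    simp only [henc] at hMo
    have hcond : (p' i0).val < (q' i0).val := by rw [hp0, ZMod.val_zero]; omega
    refine leaf2_false units PT hn hn64 hK hMo hD (fun l => ?_) ?_ ?_ h
    · have hne : (p' l).val ≠ (q' l).val := fun e => hM'.1 l (ZMod.val_injective n e)
      show (if (p' l).val < (q' l).val then p' l else q' l).val < (if (p' l).val < (q' l).val then q' l else p' l).val
      by_cases hlt : (p' l).val < (q' l).val
      · rw [if_pos hlt, if_pos hlt]; exact hlt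
      · rw [if_neg hlt, if_neg hlt]; omega
    · show (if (p' i0).val < (q' i0).val then p' i0 else q' i0) = 0
      rw [if_pos hcond, hp0]
    · show 1 ≤ (if (p' i0).val < (q' i0).val then q' i0 else p' i0).val ∧
        (if (p' i0).val < (q' i0).val then q' i0 else p' i0).val ≤ n / 2
      rw [if_pos hcond]; exact ⟨hq1, hq2⟩
  set d := (q ∘ σ) i0 - (p ∘ σ) i0 with hd
  have hd0 : d ≠ 0 := fun e => hpq (sub_eq_zero.1 e).symm
  have hdv : 1 ≤ d.val := Nat.pos_of_ne_zero fun e => hd0 ((ZMod.val_eq_zero d).1 e)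
  by_cases hle : d.val ≤ n / 2
  · -- translate by p i0
    have hM2 := hM1.map_sub (AddMonoidHom.id (ZMod n)) (fun _ _ e => e) ((p ∘ σ) i0) 0
    simp only [AddMonoidHom.id_apply, sub_zero] at hM2
    refine finish _ _ hM2 ?_ ?_ ?_
    · simp
    · simpa [hd] using hdv
    · simpa [hd] using hle
  · -- swap and translate by q i0
    have hM2 := (ModelD.swap hM1).map_sub (AddMonoidHom.id (ZMod n)) (fun _ _ e => e) ((q ∘ σ) i0) 0
    simp only [AddMonoidHom.id_apply, sub_zero] at hM2
    have hneg : (p ∘ σ) i0 - (q ∘ σ) i0 = -d := by rw [hd]; abel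
    have hnv : (-d).val = n - d.val := by rw [ZMod.neg_val, if_neg hd0]
    have hdn : d.val < n := ZMod.val_lt d
    refine finish _ _ hM2 ?_ ?_ ?_
    · simp
    · show 1 ≤ ((p ∘ σ) i0 - (q ∘ σ) i0).val
      rw [hneg, hnv]; omega
    · show ((p ∘ σ) i0 - (q ∘ σ) i0).val ≤ n / 2
      rw [hneg, hnv]; omega


end V15b

section Final2

variable {n : ℕ} [NeZero n]

/-- **THE T-FIRST KERNEL CERTIFICATE, REFLECTED THROUGH DEF. 5.1.**  If the listed units are units of `ℤ/n`
(`unitsOK`), the canonical-prefix frontier of depth `J` is contained in `roots` (`runFrontier`) and the T-first search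
below every root answers `true` (`runRoots2`, engine v1.5) — three `decide +kernel` evaluations — then `ℤ/n` admits NO STPP family
(CKSU Def. 5.1, tree `IsSTPP`) of `K` triples with `|Aᵢ| = 2`, `|Bᵢ| = |Cᵢ| = 1`.
[cite: CohnKleinbergSzegedyUmans2005, Def. 5.1] -/
theorem not_exists_isSTPP_211_of_tfirst2 (K J : ℕ) (units : List ℕ) (roots : List (List ℕ)) (hn64 : n ≤ 64)
    (hJ : 1 ≤ J) (hJK : J ≤ K) (hu : unitsOK n units = true) (hf : runFrontier n K units J roots = true)
    (hs : runRoots2 n K units roots = true) :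
    ¬ ∃ A B C : Fin K → Finset (ZMod n), IsSTPP A B C ∧
      ∀ i, (A i).card = 2 ∧ (B i).card = 1 ∧ (C i).card = 1 := by
  classical
  obtain ⟨hn2, hcop⟩ := unitsOK_true hu
  unfold runFrontier at hf
  unfold runRoots2 at hs
  rw [withTC_eq] at hf hs
  rw [force_eq] at hs
  change frontierOK (mkTC n K units) J roots = true at hf
  rw [exists_isSTPP_211_iff]
  rintro ⟨p, q, c, hpq, hDj, hX⟩
  have hM : ModelD p q c := modelD_of_finsetForm hpq hDj hX
  have hK : 1 ≤ K := by omega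
  -- the c-set and a canonical member of its orbit
  set S0 : Finset (ZMod n) := Finset.univ.image c with hS0
  obtain ⟨w, b, hcan⟩ := exists_canon S0
  set S := aff (w : ZMod n) b S0 with hS
  -- transport the solution
  have hwinj : Function.Injective (AddMonoidHom.mulLeft (w : ZMod n)) := fun x y e => by
    simpa using congrArg (fun z => ((w⁻¹ : (ZMod n)ˣ) : ZMod n) * z) e
  have hM1 := hM.map_sub (AddMonoidHom.mulLeft (w : ZMod n)) hwinj 0 b
  simp only [AddMonoidHom.coe_mulLeft, sub_zero] at hM1
  set c1 : Fin K → ZMod n := fun i => (w : ZMod n) * (c i - b) with hc1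
  have hcS : ∀ x, x ∈ S ↔ ∃ i, c1 i = x := by
    intro x
    rw [hS, aff, Finset.mem_image]
    constructor
    · rintro ⟨y, hy, rfl⟩
      rw [hS0, Finset.mem_image] at hy
      obtain ⟨i, -, rfl⟩ := hy
      exact ⟨i, rfl⟩
    · rintro ⟨i, rfl⟩
      exact ⟨c i, by rw [hS0]; exact Finset.mem_image_of_mem _ (Finset.mem_univ _), rfl⟩
  have hc1inj : Function.Injective c1 := fun i j e => by
    by_contra hij; exact hM1.c_ne hij e
  have hcard : (codes S).card = K := by
    unfold codes
    rw [Finset.card_image_of_injective _ (ZMod.val_injective n)]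
    have : S = Finset.univ.image c1 := by
      ext x; rw [hcS, Finset.mem_image]; simp [eq_comm]
    rw [this, Finset.card_image_of_injective _ hc1inj, Finset.card_univ, Fintype.card_fin]
  have h0S : (0 : ZMod n) ∈ S := zero_mem_canon ⟨c1 ⟨0, hK⟩, (hcS _).2 ⟨_, rfl⟩⟩ hcan
  -- the increasing enumeration of the codes
  let emb := (codes S).orderEmbOfFin hcard
  let t : ℕ → ℕ := fun i => if h : i < K then emb ⟨i, h⟩ else 0
  have ht : ∀ i (h : i < K), t i = emb ⟨i, h⟩ := fun i h => by simp [t, h]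
  have hC : Canon n K S t := by
    refine ⟨hcan, fun e => ?_, fun i i' hii' hi' => ?_, ?_, hK⟩
    · constructor
      · intro he
        have : e ∈ Set.range emb := by rw [Finset.range_orderEmbOfFin]; exact he
        obtain ⟨⟨i, hi⟩, rfl⟩ := this
        exact ⟨i, hi, (ht i hi).symm⟩
      · rintro ⟨i, hi, rfl⟩
        rw [ht i hi]; exact Finset.orderEmbOfFin_mem _ _ _
    · rw [ht i (by omega), ht i' hi']
      exact emb.strictMono (Fin.mk_lt_mk.2 hii')
    · rw [ht 0 hK]
      have hmin : emb ⟨0, hK⟩ ≤ 0 := by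
        have h0 : (0 : ℕ) ∈ codes S := by
          unfold codes; rw [Finset.mem_image]; exact ⟨0, h0S, ZMod.val_zero⟩
        have : (0 : ℕ) ∈ Set.range emb := by rw [Finset.range_orderEmbOfFin]; exact h0
        obtain ⟨⟨i, hi⟩, hi0⟩ := this
        have hle := emb.monotone (Fin.mk_le_mk.2 (Nat.zero_le i) : (⟨0, hK⟩ : Fin K) ≤ ⟨i, hi⟩)
        rw [hi0] at hle
        exact hle
      omega
  -- the T-phase reaches the leaf of S, and the leaf cannot refute the transported solution
  have hmem := frontier_mem units hcop hC hJ hJK hf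
  have hleaf := tleaf2_of_roots units popTable hcop hC hJ hJK hmem hs
  exact leaf2_contra units popTable (by omega) hn64 hC hM1 hcS hleaf

end Final2

end STPP211T

end Summit.MatrixMultiplication.OmegaCensus
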